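import Summits.RiemannHypothesis.RiemannHypothesis.Theorems.SoninSignMechanism
import Summits.RiemannHypothesis.RiemannHypothesis.Theorems.SemilocalSoninArchWindow
import HarnessLib

/-!
# The Sonin sign mechanism, IV — the remainder functional's sign, and the semilocal statement

Seat cc-s2-1 (gen 6).  Two corollaries that close the loop between the sign mechanism
(`SoninSignMechanism`) and the cell's typed semilocal statement (`SemilocalSoninIneqOn`):

* `re_evenFunctional_weilConv_nonpos_of_shape` — the analytic core, stated on its own: for an even
  density `x ↦ g(|x|)` with `g ∈ C²`, `g″ ≤ 0` on `[0, 2a]`, `g′(2a) ≥ 0`, and every Weil test `f`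
  supported in `[−a, a]` with the single condition `f̂(0) = 0`: `Re E₊(f ⋆ f̃) ≤ 0`
  (`E₊ = evenFunctional`).  No Hilbert space, no trace formula: pure sign.
* `soninTrace_le_archW_oneCondition_of_shape_of_family` — hence the one-condition inequality for ANY
  family predicate `V` (Sonin's space, its `θ_p`-twist, …) for which a weak trace formula (H-TF) with
  that density is assumed; and
* `semilocalSoninIneqOn_of_traceFormula_of_shape` — for `a ≤ (log 2)/2` and any prime `p`, a weak
  SEMILOCAL trace formula on the window with remainder density `g(|x|)` of that shape implies the
  cell's typed statement `SemilocalSoninIneqOn p a` (indeed with one condition to spare), via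
  `semilocalSoninIneqOn_iff_arch_of_le` (no prime enters the Weil side below `log 2`).
HONEST STATUS: at `S = {∞}` (H-TF) is CC 2021 Thm 3/4.7 (printed, not in the tree) and the shape holds
for CC's `ε` up to `2a = 0.215` (cell DATA); at `S ∋ p` the semilocal trace formula is NOT in print and
the shape hypothesis FAILS pointwise near `0` (log-periodic ripples, cell DATA) — so the third theorem
records the implication, not an instance.  No RH claim.
-/

set_option linter.dupNamespace false  -- the mandated namespace repeats `RiemannHypothesis`

noncomputable section

open MeasureTheory Set intervalIntegral Complex
open Literature.NumberTheory.LFunctions Literature.NumberTheory.ConnesConsani2021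
open scoped ComplexConjugate

namespace Summit.RiemannHypothesis.RiemannHypothesis.SoninSign

/-- **The sign of the remainder functional (one condition).**  If `g ∈ C²(ℝ)` with `g″ ≤ 0` on
`[0, 2a]` and `g′(2a) ≥ 0`, then for every Weil test `f` supported in `[−a, a]` with `f̂(0) = ∫ f = 0`:
`Re ∫ (f ⋆ f̃)(x) g(|x|) dx ≤ 0`.  Proof: `E₊(f⋆f̃) = ∫∫ g(|u−v|) f(u) f̄(v)` splits as
`g(0)|∫f|² + ∫∫ (∫₀^{|u−v|} g′) f f̄`; the first term vanishes and the second is `≤ 0` by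
`re_integral_prod_kernel_nonpos_of_concave`. [cite: ConnesConsani2021, §5 p. 20 (E₊ and the cusp ε′(1₊)); Schoenberg1938, Thm. 2] -/
theorem re_evenFunctional_weilConv_nonpos_of_shape {g : ℝ → ℝ} (hg : ContDiff ℝ 2 g) {a : ℝ}
    (ha : 0 ≤ a) (hmono : 0 ≤ deriv g (2 * a)) (hconc : ∀ s ∈ Icc 0 (2 * a), deriv (deriv g) s ≤ 0)
    {f : ℝ → ℂ} (hf : IsWeilTest f) (hfs : tsupport f ⊆ Icc (-a) a) (h0 : mulFourier f 0 = 0) :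
    (evenFunctional (fun x => ((g x : ℝ) : ℂ)) (weilConv f (weilReflect f))).re ≤ 0 := by
  have hfc : Continuous f := hf.1.continuous
  have hint0 : ∫ u, f u = 0 := by rw [← mulFourier_zero_eq_integral]; exact h0
  set P : (ℝ → ℝ) → ℂ := fun k => ∫ p : ℝ × ℝ, ((k (p.1 - p.2) : ℝ) : ℂ) * (f p.1 * conj (f p.2))
    with hP
  have hE : evenFunctional (fun x => ((g x : ℝ) : ℂ)) (weilConv f (weilReflect f)) = P (fun x => g |x|) := by
    rw [evenFunctional_weilConv_eq_pairP hfc hf.2 hg.continuous]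
  have hg1 : ContDiff ℝ 1 (deriv g) := hg.deriv'
  have hFTC : ∀ x : ℝ, g |x| = g 0 + ∫ t in (0:ℝ)..|x|, deriv g t := by
    intro x
    rw [intervalIntegral.integral_deriv_eq_sub (fun t _ => (hg.differentiable (by simp)).differentiableAt)
      ((hg.continuous_deriv (by simp)).intervalIntegrable _ _)]
    ring
  have I1 : Integrable (fun p : ℝ × ℝ => ((g 0 : ℝ) : ℂ) * (f p.1 * conj (f p.2))) :=
    integrable_pair hfc hf.2 (k := fun _ => g 0) continuous_const
  have hk2 : Continuous (fun x : ℝ => ∫ t in (0:ℝ)..|x|, deriv g t) :=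
    intervalIntegral.continuous_parametric_intervalIntegral_of_continuous (a₀ := 0)
      (f := fun (_ : ℝ) t => deriv g t) ((hg.continuous_deriv (by simp)).comp continuous_snd)
      continuous_abs
  have I2 : Integrable (fun p : ℝ × ℝ => ((∫ t in (0:ℝ)..|p.1 - p.2|, deriv g t : ℝ) : ℂ) *
      (f p.1 * conj (f p.2))) :=
    integrable_pair hfc hf.2 (k := fun x => ∫ t in (0:ℝ)..|x|, deriv g t) hk2
  have hsplit : P (fun x => g |x|) =
      P (fun _ => g 0) + P (fun x => ∫ t in (0:ℝ)..|x|, deriv g t) := by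
    simp only [hP]
    rw [← integral_add I1 I2]
    refine integral_congr_ae (Filter.Eventually.of_forall fun p => ?_)
    show (((g |p.1 - p.2| : ℝ)) : ℂ) * (f p.1 * conj (f p.2)) = _
    rw [hFTC]
    push_cast
    ring
  have hconst : P (fun _ => g 0) = 0 := by
    simp only [hP]
    have hpm : (∫ p : ℝ × ℝ, f p.1 * conj (f p.2)) = (∫ u, f u) * conj (∫ v, f v) := by
      rw [← integral_conj]
      exact MeasureTheory.integral_prod_mul (μ := (volume : Measure ℝ)) (ν := (volume : Measure ℝ))
        f (fun v => conj (f v))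
    rw [MeasureTheory.integral_const_mul, hpm, hint0, zero_mul, mul_zero]
  have hsupp' : tsupport f ⊆ Icc (-a) (-a + 2 * a) := by
    convert hfs using 2; ring
  have hneg := re_integral_prod_kernel_nonpos_of_concave (G := f) hg1 (by linarith : (0:ℝ) ≤ 2 * a)
    hmono hconc hfc hf.2 hsupp' hint0
  rw [hE, hsplit, hconst, zero_add]
  exact hneg

/-- **One condition, any family.**  For any predicate `V` on `L²(ℝ)` (Sonin's space `S(1,1)`, its
twist `θ_p S(1,1)`, …): a weak trace formula on the window `[−a, a]` with an even remainder density
`g(|x|)` of the concave-nondecreasing shape on `[0, 2a]` gives the trace inequality for every test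
supported in `[−a, a]` with the single condition `f̂(0) = 0`. [cite: ConnesConsani2021, Thm. 1 (Intro p. 4); Thm. 3 / 4.7 (the trace formula used as hypothesis)] -/
theorem soninTrace_le_archW_oneCondition_of_shape_of_family {V : Lp ℂ 2 (volume : Measure ℝ) → Prop}
    {g : ℝ → ℝ} (hg : ContDiff ℝ 2 g) {a : ℝ} (ha : 0 ≤ a) (hmono : 0 ≤ deriv g (2 * a))
    (hconc : ∀ s ∈ Icc 0 (2 * a), deriv (deriv g) s ≤ 0)
    (hTr : ∀ f : ℝ → ℂ, IsWeilTest f → tsupport f ⊆ Icc (-a) a →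
      ∀ (n : ℕ) (ξ : Fin n → Lp ℂ 2 (volume : Measure ℝ)),
        Orthonormal ℂ ξ → (∀ i, V (ξ i)) →
          ∑ i, (soninTraceForm (weilConv f (weilReflect f)) (ξ i : ℝ → ℂ)).re
            ≤ (archW (weilConv f (weilReflect f))).re
              + (evenFunctional (fun x => ((g x : ℝ) : ℂ)) (weilConv f (weilReflect f))).re)
    {f : ℝ → ℂ} (hf : IsWeilTest f) (hfs : tsupport f ⊆ Icc (-a) a) (h0 : mulFourier f 0 = 0)
    (n : ℕ) (ξ : Fin n → Lp ℂ 2 (volume : Measure ℝ)) (hξ : Orthonormal ℂ ξ) (hV : ∀ i, V (ξ i)) :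
    ∑ i, (soninTraceForm (weilConv f (weilReflect f)) (ξ i : ℝ → ℂ)).re
      ≤ (archW (weilConv f (weilReflect f))).re := by
  have hE := re_evenFunctional_weilConv_nonpos_of_shape hg ha hmono hconc hf hfs h0
  linarith [hTr f hf hfs n ξ hξ hV]

/-- **The cell's typed semilocal statement from a semilocal trace formula and the shape.**  For a
prime `p` and `a ≤ (log 2)/2`: if on the window `[−a, a]` a weak trace formula holds for orthonormal
families of the twisted Sonin space `θ_p S(1,1)` (`semilocalSoninSpace p 1 1`) with an even remainder
density `g(|x|)`, `g ∈ C²`, `g″ ≤ 0` on `[0, 2a]`, `g′(2a) ≥ 0`, then `SemilocalSoninIneqOn p a` holds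
(no prime enters the Weil side below `log 2`: `semilocalSoninIneqOn_iff_arch_of_le`).  HONEST STATUS:
the semilocal trace formula is NOT in print, and at `S ∋ p` the pointwise shape hypothesis fails near
`0` (log-periodic corner ripples, cell DATA) — this records the implication only. [cite: ConnesConsaniMoscovici2024, Introduction p. 3 (the expected semilocal comparison of the trace functional with Weil's functional)] -/
theorem semilocalSoninIneqOn_of_traceFormula_of_shape (p : ℕ) [Fact p.Prime] {g : ℝ → ℝ}
    (hg : ContDiff ℝ 2 g) {a : ℝ} (ha0 : 0 ≤ a) (ha : a ≤ Real.log 2 / 2)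
    (hmono : 0 ≤ deriv g (2 * a)) (hconc : ∀ s ∈ Icc 0 (2 * a), deriv (deriv g) s ≤ 0)
    (hTrS : ∀ f : ℝ → ℂ, IsWeilTest f → tsupport f ⊆ Icc (-a) a →
      ∀ (n : ℕ) (ξ : Fin n → Lp ℂ 2 (volume : Measure ℝ)),
        Orthonormal ℂ ξ → (∀ i, ξ i ∈ semilocalSoninSpace p 1 1) →
          ∑ i, (soninTraceForm (weilConv f (weilReflect f)) (ξ i : ℝ → ℂ)).re
            ≤ (archW (weilConv f (weilReflect f))).re
              + (evenFunctional (fun x => ((g x : ℝ) : ℂ)) (weilConv f (weilReflect f))).re) :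
    SemilocalSoninIneqOn p a := by
  rw [semilocalSoninIneqOn_iff_arch_of_le ha]
  intro f hf hfs _h1 h0 n ξ hξ hS
  exact soninTrace_le_archW_oneCondition_of_shape_of_family (V := fun η => η ∈ semilocalSoninSpace p 1 1)
    hg ha0 hmono hconc hTrS hf hfs h0 n ξ hξ hS

end Summit.RiemannHypothesis.RiemannHypothesis.SoninSign
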